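import Literature.NumberTheory.NumberFields.IdelicArtinMapKernel
import HarnessLib

/-!
# Finite idèles killed by the Artin map lie in the closure of `K^×`
# (Shimura 1998 §18.3; Tate, *Global class field theory* §5.6 — the finite-idèle reading of
# `ker [·, K] = closure(K^× · K_∞^×)` for a totally complex `K`)

Topic `Literature/NumberTheory/NumberFields`; namespace `Literature.NumberTheory.NumberFields`.  THEOREMS ONLY
(no definition, no named fact; D-0026 net debt 0).  Sequel of `…IdelicArtinMapKernel`
(`ker_ideleArtinMap_eq_topologicalClosure_of_isTotallyComplex`: for `K` totally complex,
`ker [·, K] = closure(K^× · K_∞^×)` in the idèle group).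

WHAT IS PROVED.  For a totally complex number field `K` (every CM field) and a FINITE idèle `k ∈ (𝔸_{K,f})^×`
regarded as the idèle `(1_∞, k)`:
* `ideleArtinMap_inr_eq_one_iff_mem_closure` / `mem_closure_range_unitEmbedding_of_ideleArtinMap_eq_one` —
  **`[(1,k), K] = 1` iff `k` lies in the closure of the diagonal image of `K^×` in `(𝔸_{K,f})^×`.**
  `⇒`: project `closure(K^× · K_∞^×) ⊆ 𝕀_K` to the finite part by the continuous `x ↦ x_f`, which kills `K_∞^×`
  and sends `K^×` to its diagonal image; `⇐`: `K^× ⊆ ker`, the kernel is closed and `k ↦ (1,k)` is continuous.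
This is the form in which the kernel sentence is consumed by Shimura reciprocity at CM points: two finite
idèles `s, s'` with the same Artin symbol differ by an element of `closure(K^×)` (`…UnitaryShimuraReciprocityTwist…`).

References: [Shimura1998] §18.3 p. 122 («whose kernel is the closure of the product of `M^×` and the identity
component of `M_𝐚^×`»); [TateGCFT1967] §5.6; [CasselsFrohlichANT1967] Ch. VII §5.6.
-/

set_option autoImplicit false

noncomputable section

open NumberField IsDedekindDomain

namespace Literature.NumberTheory.NumberFields

open Literature.NumberTheory.GaloisRepresentations

variable (K : Type) [Field K] [NumberField K]

/-- `x ↦ x_f` (`𝕀_K → (𝔸_{K,f})^×`) is continuous. [folklore] -/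
private theorem continuous_finPart :
    Continuous (Units.map ((RingHom.snd (InfiniteAdeleRing K) (FiniteAdeleRing (𝓞 K) K)).toMonoidHom :
      AdeleRing (𝓞 K) K →* FiniteAdeleRing (𝓞 K) K) : ideleGroup K → (FiniteAdeleRing (𝓞 K) K)ˣ) :=
  Continuous.units_map _ continuous_snd

/-- `k ↦ (1_∞, k)` (`(𝔸_{K,f})^× → 𝕀_K`) is continuous. [folklore] -/
private theorem continuous_inrIdele :
    Continuous (Units.map (MonoidHom.inr (InfiniteAdeleRing K) (FiniteAdeleRing (𝓞 K) K) :
      FiniteAdeleRing (𝓞 K) K →* AdeleRing (𝓞 K) K) : (FiniteAdeleRing (𝓞 K) K)ˣ → ideleGroup K) :=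
  Continuous.units_map _ (continuous_const.prodMk continuous_id)

/-- `((1_∞, k))_f = k`. [folklore] -/
private theorem finPart_inrIdele (k : (FiniteAdeleRing (𝓞 K) K)ˣ) :
    Units.map ((RingHom.snd (InfiniteAdeleRing K) (FiniteAdeleRing (𝓞 K) K)).toMonoidHom :
        AdeleRing (𝓞 K) K →* FiniteAdeleRing (𝓞 K) K)
      (Units.map (MonoidHom.inr (InfiniteAdeleRing K) (FiniteAdeleRing (𝓞 K) K) :
        FiniteAdeleRing (𝓞 K) K →* AdeleRing (𝓞 K) K) k) = k :=
  Units.ext rfl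

/-- The finite part of `K^× · K_∞^×` is the diagonal image of `K^×` in the finite idèles. [folklore] -/
private theorem map_finPart_le :
    (principalIdeles K ⊔ (infiniteIdeles K).range).map
        (Units.map ((RingHom.snd (InfiniteAdeleRing K) (FiniteAdeleRing (𝓞 K) K)).toMonoidHom :
          AdeleRing (𝓞 K) K →* FiniteAdeleRing (𝓞 K) K) : ideleGroup K →* (FiniteAdeleRing (𝓞 K) K)ˣ) ≤
      (FiniteAdeleRing.unitEmbedding (𝓞 K) K).range := by
  rw [Subgroup.map_sup]
  refine sup_le ?_ ?_
  · rintro _ ⟨x, ⟨a, rfl⟩, rfl⟩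
    exact ⟨a, Units.ext rfl⟩
  · rintro _ ⟨x, ⟨y, rfl⟩, rfl⟩
    exact ⟨1, Units.ext (by rw [map_one]; rfl)⟩

/-- **A finite idèle killed by the Artin map lies in the closure of `K^×`** (`K` totally complex): if
`[(1_∞, k), K] = 1` then `k ∈ closure(K^× ↪ (𝔸_{K,f})^×)`.  Finite-idèle reading of
`ker [·, K] = closure(K^× · K_∞^×)`. [cite: Shimura1998, §18.3 p. 122] [cite: TateGCFT1967, §5.6] -/
theorem mem_closure_range_unitEmbedding_of_ideleArtinMap_eq_one [IsTotallyComplex K]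
    (k : (FiniteAdeleRing (𝓞 K) K)ˣ)
    (hk : ideleArtinMap K (Units.map (MonoidHom.inr (InfiniteAdeleRing K) (FiniteAdeleRing (𝓞 K) K) :
      FiniteAdeleRing (𝓞 K) K →* AdeleRing (𝓞 K) K) k) = 1) :
    k ∈ closure (Set.range (FiniteAdeleRing.unitEmbedding (𝓞 K) K) : Set (FiniteAdeleRing (𝓞 K) K)ˣ) := by
  set ι : (FiniteAdeleRing (𝓞 K) K)ˣ →* ideleGroup K :=
    Units.map (MonoidHom.inr (InfiniteAdeleRing K) (FiniteAdeleRing (𝓞 K) K) :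
      FiniteAdeleRing (𝓞 K) K →* AdeleRing (𝓞 K) K) with hι
  set π : ideleGroup K →* (FiniteAdeleRing (𝓞 K) K)ˣ :=
    Units.map ((RingHom.snd (InfiniteAdeleRing K) (FiniteAdeleRing (𝓞 K) K)).toMonoidHom :
      AdeleRing (𝓞 K) K →* FiniteAdeleRing (𝓞 K) K) with hπ
  have hmem : ι k ∈ (principalIdeles K ⊔ (infiniteIdeles K).range).topologicalClosure := by
    rw [← ker_ideleArtinMap_eq_topologicalClosure_of_isTotallyComplex]; exact hk
  have h0 : ι k ∈ closure
      ((principalIdeles K ⊔ (infiniteIdeles K).range : Subgroup (ideleGroup K)) : Set (ideleGroup K)) := by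
    rw [← Subgroup.topologicalClosure_coe]; exact hmem
  have hπι : π (ι k) = k := finPart_inrIdele K k
  rw [← hπι]
  have h1 : π (ι k) ∈ π '' closure
      ((principalIdeles K ⊔ (infiniteIdeles K).range : Subgroup (ideleGroup K)) : Set (ideleGroup K)) :=
    ⟨_, h0, rfl⟩
  have h2 := image_closure_subset_closure_image (continuous_finPart K) h1
  refine closure_mono ?_ h2
  rintro _ ⟨x, hx, rfl⟩
  exact map_finPart_le K ⟨x, hx, rfl⟩

/-- Conversely every element of `closure(K^×)` is killed: `[(1_∞, k), K] = 1` for `k ∈ closure(K^× ↪ (𝔸_{K,f})^×)`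
(`K^× · K_∞^× ⊆ ker` for `K` totally complex, the kernel is closed, `k ↦ (1_∞,k)` is continuous; for `K = ℚ` this
fails: the finite idèle `-1` has Artin symbol complex conjugation). [cite: Shimura1998, §18.3 p. 122] -/
theorem ideleArtinMap_eq_one_of_mem_closure_range_unitEmbedding [IsTotallyComplex K]
    (k : (FiniteAdeleRing (𝓞 K) K)ˣ)
    (hk : k ∈ closure (Set.range (FiniteAdeleRing.unitEmbedding (𝓞 K) K) : Set (FiniteAdeleRing (𝓞 K) K)ˣ)) :
    ideleArtinMap K (Units.map (MonoidHom.inr (InfiniteAdeleRing K) (FiniteAdeleRing (𝓞 K) K) :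
      FiniteAdeleRing (𝓞 K) K →* AdeleRing (𝓞 K) K) k) = 1 := by
  set ι : (FiniteAdeleRing (𝓞 K) K)ˣ →* ideleGroup K :=
    Units.map (MonoidHom.inr (InfiniteAdeleRing K) (FiniteAdeleRing (𝓞 K) K) :
      FiniteAdeleRing (𝓞 K) K →* AdeleRing (𝓞 K) K) with hι
  -- the closed set `{k : [(1,k), K] = 1}` contains `K^×`
  have hcl : IsClosed {k : (FiniteAdeleRing (𝓞 K) K)ˣ | ideleArtinMap K (ι k) = 1} := by
    have : {k : (FiniteAdeleRing (𝓞 K) K)ˣ | ideleArtinMap K (ι k) = 1} =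
        ι ⁻¹' ((ideleArtinMap K).ker : Set (ideleGroup K)) := rfl
    rw [this]
    exact (isClosed_ker_ideleArtinMap (K := K)).preimage (continuous_inrIdele K)
  have hsub : (Set.range (FiniteAdeleRing.unitEmbedding (𝓞 K) K) : Set (FiniteAdeleRing (𝓞 K) K)ˣ) ⊆
      {k | ideleArtinMap K (ι k) = 1} := by
    rintro _ ⟨a, rfl⟩
    -- `(1_∞, a) = a · (a_∞⁻¹, 1)`: principal times archimedean
    have hsplit : ι (FiniteAdeleRing.unitEmbedding (𝓞 K) K a) =
        Units.map (algebraMap K (AdeleRing (𝓞 K) K) : K →* AdeleRing (𝓞 K) K) a *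
          infiniteIdeles K (Units.map (algebraMap K (InfiniteAdeleRing K) : K →* InfiniteAdeleRing K) a⁻¹) := by
      apply Units.ext
      refine Prod.ext ?_ ?_
      · change (1 : InfiniteAdeleRing K) =
          algebraMap K (InfiniteAdeleRing K) (a : K) * algebraMap K (InfiniteAdeleRing K) ((a⁻¹ : Kˣ) : K)
        rw [← map_mul, Units.mul_inv, map_one]
      · change algebraMap K (FiniteAdeleRing (𝓞 K) K) (a : K) = algebraMap K (FiniteAdeleRing (𝓞 K) K) (a : K) * 1
        rw [mul_one]
    change ideleArtinMap K (ι (FiniteAdeleRing.unitEmbedding (𝓞 K) K a)) = 1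
    rw [hsplit, map_mul, ideleArtinMap_principalIdele, one_mul, ideleArtinMap_infiniteIdeles]
  exact hcl.closure_subset_iff.2 hsub hk

/-- **`[(1_∞, k), K] = 1 ↔ k ∈ closure(K^×)`** for a finite idèle `k` of a totally complex `K`.
[cite: Shimura1998, §18.3 p. 122] [cite: TateGCFT1967, §5.6] -/
theorem ideleArtinMap_inr_eq_one_iff_mem_closure [IsTotallyComplex K] (k : (FiniteAdeleRing (𝓞 K) K)ˣ) :
    ideleArtinMap K (Units.map (MonoidHom.inr (InfiniteAdeleRing K) (FiniteAdeleRing (𝓞 K) K) :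
      FiniteAdeleRing (𝓞 K) K →* AdeleRing (𝓞 K) K) k) = 1 ↔
    k ∈ closure (Set.range (FiniteAdeleRing.unitEmbedding (𝓞 K) K) : Set (FiniteAdeleRing (𝓞 K) K)ˣ) :=
  ⟨mem_closure_range_unitEmbedding_of_ideleArtinMap_eq_one K k,
    ideleArtinMap_eq_one_of_mem_closure_range_unitEmbedding K k⟩

end Literature.NumberTheory.NumberFields

end
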